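import Mathlib
import HarnessLib
import Summits.HubbardSuperconductivity.HubbardSuperconductivity.Theorems.KLProgrammeKLRegimeEngineLadderIncrement

/-!
# Route `KLProgramme` — ENGINE child gen 8 (stmt-HubbardSuperconductivity-20437 `KLRegimeEngineV17F2`), skeleton v2 class #5 rev 3:
# finite-sum lemmas for the RESOLVED two-sided dressed Duhamel bound (`…EnginePairLadderResolvedDuhamel`)
# (cell gate-hubbard-kl, seat hubbard-kl-k3c1-p1 g15, technique «composed-map remainder propagation»)

WHY.  The resolved Duhamel door `kltc_resolved_dressing_duhamel` (next file) bounds the two-sided linearly dressed flow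
`Ė = −(Γ₁·diag ḃ₁·E + E·diag ḃ₂·Γ₂) + X` entrywise by the adjoint-supersolution method: for fixed `(x,y)` the weights
`φ_s(a) = δ_{xa} + (3m/2)v₁(s,a)`, `ψ_s(c) = δ_{cy} + v₂(s,c)(3m/2)` on remaining-variation majorants `vᵢ` of the rates make
`Σ_{a,c} φ_s(a)‖E(s)(a,c)‖ψ_s(c)` a sub-solution.  This file isolates the three model-free finite-sum facts it uses:
`kltc_rd_fourTerm_expand` (the four-term FT shape of `Σ_aΣ_c (δ+p)G(δ+q)`), `kltc_rd_entry_rate_le` (entry rate of the dressed flow),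
`kltc_rd_supersolution_le` (the dressing is absorbed by the decay of the weights when `ΣP, ΣQ ≤ 3/2`).
Finite sums only; nothing about the model is asserted; nothing asserts (X).3, (c), K3 or superconductivity.  0 kit · 0 lit.
-/

noncomputable section

namespace Summit.HubbardSuperconductivity.HubbardSuperconductivity.Theorems.KLRegimeSplit

set_option linter.dupNamespace false -- summit = problem name (single-conjunct summit), D-0017

open Finset Matrix Set
open Summit.HubbardSuperconductivity.HubbardSuperconductivity.Theorems.KLProgrammeCooperResummation

/-! ## §1 Finite-sum helpers -/

section Helpers

variable {ι : Type*} [Fintype ι] [DecidableEq ι]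

/-- **Four-term expansion** of the weighted double sum `Σ_aΣ_c (δ_{ax} + p a)·G(a,c)·(δ_{cy} + q c)`. -/
theorem kltc_rd_fourTerm_expand (G : ι → ι → ℝ) (p q : ι → ℝ) (x y : ι) :
    ∑ a, ∑ c, ((if a = x then (1 : ℝ) else 0) + p a) * G a c * ((if c = y then (1 : ℝ) else 0) + q c) =
      G x y + ∑ c, G x c * q c + ∑ a, p a * G a y + ∑ a, ∑ c, p a * G a c * q c := by
  have hsplit : ∀ a c, ((if a = x then (1 : ℝ) else 0) + p a) * G a c * ((if c = y then (1 : ℝ) else 0) + q c) =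
      (if a = x then (1 : ℝ) else 0) * (G a c * (if c = y then (1 : ℝ) else 0)) +
        (if a = x then (1 : ℝ) else 0) * (G a c * q c) + p a * G a c * (if c = y then (1 : ℝ) else 0) + p a * G a c * q c := by
    intro a c; ring
  simp_rw [hsplit, sum_add_distrib]
  have h1 : ∑ a, ∑ c, (if a = x then (1 : ℝ) else 0) * (G a c * (if c = y then (1 : ℝ) else 0)) = G x y := by
    rw [sum_comm]
    simp only [boole_mul, mul_boole, sum_ite_eq', Finset.mem_univ, if_true]
  have h2 : ∑ a, ∑ c, (if a = x then (1 : ℝ) else 0) * (G a c * q c) = ∑ c, G x c * q c := by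
    rw [sum_comm]
    simp only [boole_mul, sum_ite_eq', Finset.mem_univ, if_true]
  have h3 : ∑ a, ∑ c, p a * G a c * (if c = y then (1 : ℝ) else 0) = ∑ a, p a * G a y := by
    refine sum_congr rfl fun a _ => ?_
    simp only [mul_boole, sum_ite_eq', Finset.mem_univ, if_true]
  rw [h1, h2, h3]

/-- **Entry rate of the two-sided dressed flow**: `|Γᵢ| ≤ m` ⇒
`‖(−(Γ₁·diag d₁·E + E·diag d₂·Γ₂) + X)(a,c)‖ ≤ m·Σ_{a′}‖d₁ a′‖‖E a′ c‖ + m·Σ_{c′}‖E a c′‖‖d₂ c′‖ + ‖X a c‖`. -/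
theorem kltc_rd_entry_rate_le (Γ₁ Γ₂ E X : Matrix ι ι ℂ) (d₁ d₂ : ι → ℂ) {m : ℝ}
    (hΓ₁ : ∀ x y, ‖Γ₁ x y‖ ≤ m) (hΓ₂ : ∀ x y, ‖Γ₂ x y‖ ≤ m) (a c : ι) :
    ‖(-(Γ₁ * diagonal d₁ * E + E * diagonal d₂ * Γ₂) + X) a c‖ ≤
      m * ∑ a', ‖d₁ a'‖ * ‖E a' c‖ + m * ∑ c', ‖E a c'‖ * ‖d₂ c'‖ + ‖X a c‖ := by
  rw [Matrix.add_apply, Matrix.neg_apply, Matrix.add_apply]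
  have h1 : ‖(Γ₁ * diagonal d₁ * E) a c‖ ≤ m * ∑ a', ‖d₁ a'‖ * ‖E a' c‖ := by
    rw [klli_mul_diag_mul_apply, mul_sum]
    refine (norm_sum_le _ _).trans (sum_le_sum fun a' _ => ?_)
    rw [norm_mul, norm_mul, ← mul_assoc]
    exact mul_le_mul_of_nonneg_right (mul_le_mul_of_nonneg_right (hΓ₁ a a') (norm_nonneg _)) (norm_nonneg _)
  have h2 : ‖(E * diagonal d₂ * Γ₂) a c‖ ≤ m * ∑ c', ‖E a c'‖ * ‖d₂ c'‖ := by
    rw [klli_mul_diag_mul_apply, mul_sum]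
    refine (norm_sum_le _ _).trans (sum_le_sum fun c' _ => ?_)
    rw [norm_mul, norm_mul]
    calc ‖E a c'‖ * ‖d₂ c'‖ * ‖Γ₂ c' c‖ ≤ ‖E a c'‖ * ‖d₂ c'‖ * m :=
          mul_le_mul_of_nonneg_left (hΓ₂ c' c) (mul_nonneg (norm_nonneg _) (norm_nonneg _))
      _ = m * (‖E a c'‖ * ‖d₂ c'‖) := by ring
  calc ‖-((Γ₁ * diagonal d₁ * E) a c + (E * diagonal d₂ * Γ₂) a c) + X a c‖
      ≤ ‖-((Γ₁ * diagonal d₁ * E) a c + (E * diagonal d₂ * Γ₂) a c)‖ + ‖X a c‖ := norm_add_le _ _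
    _ ≤ (‖(Γ₁ * diagonal d₁ * E) a c‖ + ‖(E * diagonal d₂ * Γ₂) a c‖) + ‖X a c‖ := by
        rw [norm_neg]; exact add_le_add (norm_add_le _ _) le_rfl
    _ ≤ _ := add_le_add (add_le_add h1 h2) le_rfl

omit [DecidableEq ι] in
/-- **The supersolution inequality (finite sums).**  Nonnegative weights `P Q` with `ΣP ≤ 3/2`, `ΣQ ≤ 3/2`, slopes `P′ ≤ −(3m/2)·r₁`, `Q′ ≤ −r₂·(3m/2)`
(`rᵢ ≥ 0` the rate moduli), nonnegative `uu`, and an entry rate `D ≤ m·Σ_{a′} r₁ a′·uu a′ c + m·Σ_{c′} uu a c′·r₂ c′ + Xn`: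
`Σ_aΣ_c ((P′a·Qc + Pa·Q′c)·uu a c + Pa·Qc·D a c) ≤ Σ_aΣ_c Pa·Xn a c·Qc` — the dressing is absorbed by the decay of the weights. -/
theorem kltc_rd_supersolution_le (P Q P' Q' r₁ r₂ : ι → ℝ) (uu D Xn : ι → ι → ℝ) {m : ℝ} (hm : 0 ≤ m)
    (hP : ∀ a, 0 ≤ P a) (hQ : ∀ c, 0 ≤ Q c) (hr₁ : ∀ a, 0 ≤ r₁ a) (hr₂ : ∀ c, 0 ≤ r₂ c) (huu : ∀ a c, 0 ≤ uu a c)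
    (hP' : ∀ a, P' a ≤ -(3 / 2 * m * r₁ a)) (hQ' : ∀ c, Q' c ≤ -(r₂ c * (3 / 2 * m)))
    (hSP : ∑ a, P a ≤ 3 / 2) (hSQ : ∑ c, Q c ≤ 3 / 2)
    (hD : ∀ a c, D a c ≤ m * ∑ a', r₁ a' * uu a' c + m * ∑ c', uu a c' * r₂ c' + Xn a c) :
    ∑ a, ∑ c, ((P' a * Q c + P a * Q' c) * uu a c + P a * Q c * D a c) ≤ ∑ a, ∑ c, P a * Xn a c * Q c := by
  -- abbreviations for the two transport masses
  obtain ⟨W₁, hW₁⟩ : ∃ W : ι → ℝ, W = fun c => ∑ a', r₁ a' * uu a' c := ⟨_, rfl⟩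
  obtain ⟨W₂, hW₂⟩ : ∃ W : ι → ℝ, W = fun a => ∑ c', uu a c' * r₂ c' := ⟨_, rfl⟩
  have hW₁0 : ∀ c, 0 ≤ W₁ c := fun c => by rw [hW₁]; exact sum_nonneg fun a' _ => mul_nonneg (hr₁ a') (huu a' c)
  have hW₂0 : ∀ a, 0 ≤ W₂ a := fun a => by rw [hW₂]; exact sum_nonneg fun c' _ => mul_nonneg (huu a c') (hr₂ c')
  have hD' : ∀ a c, D a c ≤ m * W₁ c + m * W₂ a + Xn a c := fun a c => by rw [hW₁, hW₂]; exact hD a c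
  -- insert the entry rate
  have step1 : ∑ a, ∑ c, ((P' a * Q c + P a * Q' c) * uu a c + P a * Q c * D a c) ≤
      ∑ a, ∑ c, ((P' a * Q c + P a * Q' c) * uu a c + P a * Q c * (m * W₁ c + m * W₂ a + Xn a c)) := by
    refine sum_le_sum fun a _ => sum_le_sum fun c _ => add_le_add le_rfl ?_
    exact mul_le_mul_of_nonneg_left (hD' a c) (mul_nonneg (hP a) (hQ c))
  -- split into the row part, the column part and the source part
  have step2 : ∑ a, ∑ c, ((P' a * Q c + P a * Q' c) * uu a c + P a * Q c * (m * W₁ c + m * W₂ a + Xn a c)) =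
      ∑ a, ∑ c, (P' a * Q c * uu a c + P a * Q c * (m * W₁ c)) +
        ∑ a, ∑ c, (P a * Q' c * uu a c + P a * Q c * (m * W₂ a)) + ∑ a, ∑ c, P a * Xn a c * Q c := by
    rw [← sum_add_distrib, ← sum_add_distrib]
    refine sum_congr rfl fun a _ => ?_
    rw [← sum_add_distrib, ← sum_add_distrib]
    refine sum_congr rfl fun c _ => ?_
    ring
  -- the row part is nonpositive
  have hrow : ∑ a, ∑ c, (P' a * Q c * uu a c + P a * Q c * (m * W₁ c)) ≤ 0 := by
    rw [sum_comm]
    refine sum_nonpos fun c _ => ?_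
    have hfac : ∑ a, (P' a * Q c * uu a c + P a * Q c * (m * W₁ c)) =
        Q c * (∑ a, P' a * uu a c) + Q c * (m * W₁ c) * ∑ a, P a := by
      rw [sum_add_distrib]
      congr 1
      · rw [mul_sum]; exact sum_congr rfl fun a _ => by ring
      · rw [mul_sum]; exact sum_congr rfl fun a _ => by ring
    rw [hfac]
    have hS : ∑ a, P' a * uu a c ≤ -(3 / 2 * m * W₁ c) := by
      have : ∑ a, P' a * uu a c ≤ ∑ a, -(3 / 2 * m * r₁ a) * uu a c :=
        sum_le_sum fun a _ => mul_le_mul_of_nonneg_right (hP' a) (huu a c)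
      refine this.trans (le_of_eq ?_)
      rw [hW₁]
      simp only [mul_sum, ← sum_neg_distrib]
      exact sum_congr rfl fun a _ => by ring
    have h1 : Q c * (∑ a, P' a * uu a c) ≤ Q c * (-(3 / 2 * m * W₁ c)) := mul_le_mul_of_nonneg_left hS (hQ c)
    have h2 : Q c * (m * W₁ c) * ∑ a, P a ≤ Q c * (m * W₁ c) * (3 / 2) :=
      mul_le_mul_of_nonneg_left hSP (mul_nonneg (hQ c) (mul_nonneg hm (hW₁0 c)))
    have h3 : Q c * (-(3 / 2 * m * W₁ c)) + Q c * (m * W₁ c) * (3 / 2) = 0 := by ring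
    linarith
  -- the column part is nonpositive
  have hcol : ∑ a, ∑ c, (P a * Q' c * uu a c + P a * Q c * (m * W₂ a)) ≤ 0 := by
    refine sum_nonpos fun a _ => ?_
    have hfac : ∑ c, (P a * Q' c * uu a c + P a * Q c * (m * W₂ a)) =
        P a * (∑ c, Q' c * uu a c) + P a * (m * W₂ a) * ∑ c, Q c := by
      rw [sum_add_distrib]
      congr 1
      · rw [mul_sum]; exact sum_congr rfl fun c _ => by ring
      · rw [mul_sum]; exact sum_congr rfl fun c _ => by ring
    rw [hfac]
    have hS : ∑ c, Q' c * uu a c ≤ -(3 / 2 * m * W₂ a) := by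
      have : ∑ c, Q' c * uu a c ≤ ∑ c, -(r₂ c * (3 / 2 * m)) * uu a c :=
        sum_le_sum fun c _ => mul_le_mul_of_nonneg_right (hQ' c) (huu a c)
      refine this.trans (le_of_eq ?_)
      rw [hW₂]
      simp only [mul_sum, ← sum_neg_distrib]
      exact sum_congr rfl fun c _ => by ring
    have h1 : P a * (∑ c, Q' c * uu a c) ≤ P a * (-(3 / 2 * m * W₂ a)) := mul_le_mul_of_nonneg_left hS (hP a)
    have h2 : P a * (m * W₂ a) * ∑ c, Q c ≤ P a * (m * W₂ a) * (3 / 2) :=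
      mul_le_mul_of_nonneg_left hSQ (mul_nonneg (hP a) (mul_nonneg hm (hW₂0 a)))
    have h3 : P a * (-(3 / 2 * m * W₂ a)) + P a * (m * W₂ a) * (3 / 2) = 0 := by ring
    linarith
  rw [step2] at step1
  linarith

end Helpers

end Summit.HubbardSuperconductivity.HubbardSuperconductivity.Theorems.KLRegimeSplit

end
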